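import Summits.AtomisticToContinuum.Crystallization.Theorems.FrustratedLawDichotomyStrainedPatchHomEntryLeafHTCross095hA

/-!
# CROSSOVER CELL of the analytic-slab leaf at `0.95 t_b` (`U 2⁻¹³`), part B: the matrix-shifted curvature certificate and the chunked slope certificate

decomp-a2c hand-1 g31 (crux `AperiodicFrustratedLawGap`, stmt-AtomisticToContinuum-27623).  See `…Cross095hA` for the cell `cX95h × wXh` and the certificate `pX95h`.
Kernel facts: `curvCheckLJM_X95h` (`DX`-shifted centred LJ force-Jacobian certificate on the near labels at floor `1.295·SC`), `slope_near_X95h`, `slope_far1_X95h`,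
`slope_far2_X95h` (naive guards + `htGs ≤ 613·10⁹ / 5.2·10⁹ / 2.8·10⁹`; sum `≤ pX95h.Gs = 625·10⁹`), and the assembly `htCertSide_X95h` (every certificate
conjunct of the slab leaf, by rewriting — no long `decide`).

Kernel facts + assembly; 0 sorry; standard axioms.  `--supports stmt-AtomisticToContinuum-27623`.
-/

namespace Summit.AtomisticToContinuum.Crystallization.Theorems.FrustratedLawDichotomyStrainedPatchHomEntryLeafHT

open Literature.Analysis.ValidatedNumerics.Numerics
open Summit.AtomisticToContinuum.Crystallization.Theorems.FrustratedLawDichotomyStrainedPatchHomCurvLJ (curvCheckLJM)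
open Summit.AtomisticToContinuum.Crystallization.Theorems.FrustratedLawDichotomyStrainedPatchHomForceJacN (forceJacCheckN)
open Summit.AtomisticToContinuum.Crystallization.Theorems.FrustratedLawDichotomyStrainedPatchHomForceHcp (xiBallOK)
open Summit.AtomisticToContinuum.Crystallization.Theorems.FrustratedLawDichotomyStrainedPatchHomCertTree (CertTree treeOK)
open Summit.AtomisticToContinuum.Crystallization.Theorems.FrustratedLawDichotomyStrainedPatchHomEntryTable (muRec)
open Summit.AtomisticToContinuum.Crystallization.Theorems.FrustratedLawDichotomyStrainedPatchHomEntryFitHcpCentred (fitOKHD entryLeafOKHQD entryLeafOKHT4QD)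

/-- ★ KERNEL: the `DX`-shifted centred LJ force-Jacobian certificate on the near labels of the cell certifies the floor `1.295·SC`. -/
theorem curvCheckLJM_X95h : curvCheckLJM cX95h wXh (htCen cX95h wXh) (htNai cX95h wXh) DX 364510094840300 = true := by
  decide +kernel

/-- ★ KERNEL: chunked slope, near chunk (350 labels): `htGs ≤ 1249·10⁹` (`0.00444·SC`). -/
theorem slope_near_X95h : (htNaiOK cX95h wXh (htNear cX95h wXh) && decide (htGs cX95h wXh (htNear cX95h wXh) ≤ 613000000000)) = true := by
  decide +kernel

/-- ★ KERNEL: chunked slope, far chunk 1: `htGs ≤ 5.65·10⁹`. -/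
theorem slope_far1_X95h : (htNaiOK cX95h wXh (htFar1 cX95h wXh) && decide (htGs cX95h wXh (htFar1 cX95h wXh) ≤ 5200000000)) = true := by
  decide +kernel

/-- ★ KERNEL: chunked slope, far chunk 2: `htGs ≤ 2.2·10⁹`. -/
theorem slope_far2_X95h : (htNaiOK cX95h wXh (htFar2 cX95h wXh) && decide (htGs cX95h wXh (htFar2 cX95h wXh) ≤ 2800000000)) = true := by
  decide +kernel

/-- The three chunk slope constants sum below `pX95h.Gs`. [arithmetic on the kernel facts] -/
theorem htGs_sum_X95h : decide (htGs cX95h wXh (htNear cX95h wXh) + htGs cX95h wXh (htFar1 cX95h wXh) + htGs cX95h wXh (htFar2 cX95h wXh) ≤ pX95h.Gs) = true := by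
  have h1 := slope_near_X95h
  have h2 := slope_far1_X95h
  have h3 := slope_far2_X95h
  simp only [Bool.and_eq_true, decide_eq_true_eq] at h1 h2 h3 ⊢
  have e : pX95h.Gs = 625000000000 := rfl
  rw [e]
  linarith [h1.2, h2.2, h3.2]

/-- ★★ Every certificate conjunct of the slab leaf holds on the crossover cell. [assembly by rewriting] -/
theorem htCertSide_X95h : htCertSide pX95h cX95h wXh = true := by
  have h1 := slope_near_X95h
  have h2 := slope_far1_X95h
  have h3 := slope_far2_X95h
  simp only [Bool.and_eq_true] at h1 h2 h3
  rw [htCertSide, show pX95h.D = DX from rfl, show pX95h.lam₁ = 364510094840300 from rfl, show pX95h.lam₂ = -2814749767106 from rfl,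
    show pX95h.lam₃ = -2814749767106 from rfl, xiBallOK_X95h, htROK_X95h, htCertOK_X95h, curvCheckLJM_X95h, far1_X95h, far2_X95h, h1.1, h2.1, h3.1, htGs_sum_X95h]
  simp

end Summit.AtomisticToContinuum.Crystallization.Theorems.FrustratedLawDichotomyStrainedPatchHomEntryLeafHT
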